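import Summits.QuantumFields.BalabanUV.T4Continuum.Support.InsertionChannelReading
import Summits.QuantumFields.BalabanUV.T4Continuum.Support.B13Carriers

/-!
# InsertionChannelInstance — THE READING BY CONSTRUCTION: on carriers with finitely many domains per creation step, the history
# insertion that READS a localization channel of row NE9 (`InsertionChannelReading.ReadsChannel`) EXISTS — `insOfChannel` — for every
# ADDITIVE channel with the printed step-sum structure and row NE9's size binder S5, so that the NE5-W3 × NE9-S5 junction
# (`InsertionChannelReading`, `InsertionChannelEnd`) is NOT VACUOUS there; corollaries for NE9-P1's piece form and NE9-P2's evaluation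
# channels BY NAME
# (cell `pub-balaban`, T⁴ fan-out; row O1-c HISTORY ∕ TABLES holder; owner list «MI-R incl. the reading» (R35); journal INTENT «THE READING
# BY CONSTRUCTION»)

Unit `b2b-balaban-t4-ne5-formalise-leaf-06` (NE5 formalisation swarm, leaf prover 06, gen 2).  Summits-side NEW WORK under the LEAN
PLACEMENT RULE (cell modelling + bookkeeping; nothing of the manuscripts under audit is asserted; 0 cite tags).  HONEST FRAMING: rung (B)+1 of
the FINITE-VOLUME T⁴ continuum programme — NOT infinite volume, NOT a mass gap, NOT the Clay problem, NOT a proof of NE5 (NOT PRINTED; cell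
GAPS G-t4-U3-1) nor of NE9; spine 0/9 unchanged.  HONEST DEPENDENCY (cell line, verbatim): continuum YM on T⁴ ⇐ BetaPertH ∧ nine spine
estimates (0/9 proved); BetaPertH ⇐ (D1) ∧ (D4) ∧ CAP+tail; G-an2-4 gates asym, D1 and NE2/3/4.

WHY.  `ReadsChannel.succ` (p217199) asks, for EVERY table `t : C.Dom → ℝ`, that the table-driven part of the step-`(k+1)` inserted
history read at the entry `i` be the channel output `T k g (constFam t) (out i)`; the inserted history is a vector of the Hist of record
`B13HistDatum.Hist F` (entries bounded against their level formats `F.wt`).  On carriers with infinitely many domains PER creation step an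
unbounded table can make `i ↦ T k g (constFam t) (out i)` unbounded against `F.wt` — then no step model reads the channel and the
junction's faces are vacuous for that channel.  On carriers with FINITELY MANY DOMAINS PER CREATION STEP (the carriers of record:
`B13Carriers` §3, `domAt j : Finset`), for a channel that is ADDITIVE, has the printed STEP-SUM structure (`ChannelStepSum`: (1.33) p. 9 of
[II] sums the one-creation-step contributions, PROVED for NE9's piece and evaluation forms) and obeys S5 (`ChannelSizeAtStepNN`) with the
weight dictionary, every table's channel output IS bounded against the level formats (`exists_bound_channelTable`): the insertion
`insOfChannel` below is then a genuine Hist-valued map and READS the channel BY CONSTRUCTION (`readsChannel_of_insA_eq`) — the MI-R-class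
identification `ReadsChannel` becomes a definition, exactly as `B13HistInsertion.KernelDatum.toInsDatum` ∕ `readsIns_of_reads` did for
the finite-rank class.  MODEL LEVEL throughout: which step model has `insA = insOfChannel …` for Bałaban's (1.33) is the instantiation
(0/12), not this file.

WHAT THIS FILE TYPES ([folklore] bookkeeping; 0 sorry):
* §1 `tableOf F V : Hist F` — the Hist vector with prescribed PHYSICAL entries `V : F.Idx → ℂ` when they are bounded against the level
  formats (else `0`); `read_tableOf`.
* §2 `insOfChannel T out g k t : Hist F` (step `0` ↦ `0`; step `k+1` ↦ `tableOf` of `i ↦ T k g (constFam t) (out i)`); the boundedness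
  shape `ChannelTablesBounded T out W` (bookkeeping, NOT an estimate of the series: «every table's constant-family output is a Hist vector»);
  **`readsChannel_of_insA_eq`**: `insA = insOfChannel` on the window + `ChannelTablesBounded` + `T k g 0 = 0` ⟹ `ReadsChannel M T out W`.
* §3 **`channelTablesBounded_of_size`**: `ChannelTablesBounded` DISCHARGED from a scale catalogue `domAt : ℕ → Finset C.Dom`
  (`∀ X, X ∈ domAt (C.scale X)`), admissible constant families, `ChannelStepSum Adm T`, `ChannelSizeAtStepNN Adm T κ wt τ`, `0 ≤ τ`, and the
  weight dictionary `wt k (out i) ≤ rH k·F.wt i` (the scale-`j` majorant of a table is `Σ_{X ∈ domAt j} |t X|·e^{κd(X)}`);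
  `channel_zero_of_additive` (`T k g 0 = 0` from `ChannelAdditive`); **`readsChannel_insOfChannel`** (the reading BY CONSTRUCTION from the
  channel's printed-structure binders + S5 + the weight dictionary + the scale catalogue).
* §5 `scaleCatalogue_record`, **`readsChannel_insOfChannel_record`**: on the carriers of record `B13Carriers.TwoRuns.carriers R` the scale
  catalogue is `R.domAt` (`TwoRuns.mem_domAt`) — the finiteness hypothesis is MET, the reading holds by construction there.
* §4 corollaries BY NAME: `readsChannel_insOfPieceChannel` (NE9-P1's `pieceChannel P` — `channelStepSum_piece` ∕ `channelAdditive_piece` on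
  `univ`, the size from `SrcScale` + `PieceBound` + `LevelCounts`, `1 < L`, via `channelSizeAtStepNN_piece_printed`) and
  `readsChannel_insOfEvalChannel` (NE9-P2's `evalChannel F₀ ν w bg` — `channelStepSum_eval`, `channelAdditive_eval`, the size from the
  kernel-mass inequality via `channelSizeAtStepNN_of_kernelMass`).
STATUS (census, Edison rule).  Construction∕bookkeeping; discharges NO estimate of [II]; de-vacuifies the reading of p217199∕p218126 on
finite-per-scale carriers; NE5 NOT PROVED; NE9 NOT PROVED; 0/12 leaves on Bałaban's concrete objects; spine 0/9; rung (B)+1 finite T⁴; NOT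
infinite volume ∕ mass gap ∕ Clay.  Axioms ⊆ {propext, Classical.choice, Quot.sound}.
-/

noncomputable section

open scoped BigOperators
open Finset MeasureTheory

namespace Summit.QuantumFields.BalabanUV.T4Continuum.InsertionChannelInstance

open Literature.MathematicalPhysics.QuantumFieldTheory.Balaban1983to89
open Literature.MathematicalPhysics.QuantumFieldTheory.Balaban1983to89.T4OutputRate (Carriers)
open Literature.MathematicalPhysics.QuantumFieldTheory.Balaban1983to89.T4InputCauchyRateData (StepModel)
open Literature.MathematicalPhysics.QuantumFieldTheory.Balaban1983to89.T4HistoryLipschitzRecursion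
  (ChannelAdditive ChannelStepSum ChannelSizeAtStepNN restrictScale)
open Summit.QuantumFields.BalabanUV.T4Continuum.B13HistDatum (HistFrame Entry Hist)
open Summit.QuantumFields.BalabanUV.T4Continuum.NE9EvaluationChannel (evalChannel EvalAdm channelAdditive_eval channelStepSum_eval
  channelSizeAtStepNN_of_kernelMass)
open Summit.QuantumFields.BalabanUV.T4Continuum.NE9Lemma1Counting (PieceData pieceChannel SrcScale PieceBound LevelCounts weightOf
  ellPrinted channelAdditive_piece channelStepSum_piece channelSizeAtStepNN_piece_printed)
open Summit.QuantumFields.BalabanUV.T4Continuum.InsertionChannelReading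

variable {C : Carriers} {Bg ι : Type} {F : HistFrame C}

/-! ## §1 Hist vectors with prescribed physical entries -/

section TableOf

variable (F)

/-- [folklore] The Hist vector whose PHYSICAL entries are `V : F.Idx → ℂ`, when `V` is bounded against the level formats
(`∃ μ, ∀ i, ‖V i‖ ≤ μ·F.wt i`) — `HistFrame.ofBound` at a chosen bound; the zero vector otherwise (junk value, never read). -/
def tableOf (V : F.Idx → ℂ) : Hist F :=
  open Classical in
  if h : ∃ μ : ℝ, ∀ i, ‖V i‖ ≤ μ * F.wt i then F.ofBound V h.choose h.choose_spec else 0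

variable {F}

/-- [folklore] The physical entries of `tableOf F V` ARE `V` when `V` is bounded against the level formats. -/
theorem read_tableOf {V : F.Idx → ℂ} (h : ∃ μ : ℝ, ∀ i, ‖V i‖ ≤ μ * F.wt i) (i : F.Idx) : F.read (tableOf F V) i = V i := by
  classical
  rw [tableOf, dif_pos h, HistFrame.read_ofBound]

end TableOf

/-! ## §2 The insertion of a channel and the reading by construction -/

section InsOfChannel

variable (T : ℕ → (ℕ → ℝ) → (Bg → C.Dom → ℝ) → ι → ℝ) (out : F.Idx → ι)

/-- [folklore] The step-`k` channel's constant-family output table of the table `t`, as PHYSICAL entries of the frame. -/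
def channelTable (k : ℕ) (g : ℕ → ℝ) (t : C.Dom → ℝ) : F.Idx → ℂ := fun i => ((T k g (constFam t) (out i) : ℝ) : ℂ)

/-- [folklore] THE INSERTION OF A CHANNEL: step `0` inserts nothing; step `k + 1` inserts the Hist vector whose physical entries are the
step-`k` channel outputs on the background-constant family of the table (the run's couplings as the comparison history; the background
argument of the entry is carried by the frame's entry index, as in `B13HistDatum.PotFrame`). -/
def insOfChannel (g : ℕ → ℝ) : ℕ → (C.Dom → ℝ) → Hist F
  | 0, _ => 0
  | k + 1, t => tableOf F (channelTable T out k g t)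

/-- [folklore] HYPOTHESIS SHAPE `ChannelTablesBounded T out W` (bookkeeping about the Hist of record, NOT an estimate of the series —
DISCHARGED in §3 on finite-per-scale carriers): on the window, every table's constant-family channel output is bounded against the level
formats, i.e. is the family of physical entries of a Hist vector. -/
def ChannelTablesBounded (W : Set (ℕ → ℝ)) : Prop :=
  ∀ k, ∀ g ∈ W, ∀ t : C.Dom → ℝ, ∃ μ : ℝ, ∀ i : F.Idx, ‖channelTable T out k g t i‖ ≤ μ * F.wt i

variable {T out} {Op : Type*} [NormedAddCommGroup Op] [NormedSpace ℂ Op] {M : StepModel C Op (Hist F)} {W : Set (ℕ → ℝ)}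

/-- [folklore] **THE READING BY CONSTRUCTION**: a step model whose run-A insertion IS `insOfChannel T out` on the window READS the channel
(`ReadsChannel M T out W`), provided the channel tables are Hist vectors (`ChannelTablesBounded`) and the channel kills the zero family
(`T k g 0 = 0`, from additivity). -/
theorem readsChannel_of_insA_eq (hins : ∀ k, ∀ g ∈ W, ∀ (U : C.BgB) (t : C.Dom → ℝ), M.insA g U k t = insOfChannel T out g k t)
    (hbdd : ChannelTablesBounded T out W) (hT0 : ∀ k, ∀ g ∈ W, ∀ y : ι, T k g 0 y = 0) : ReadsChannel M T out W where
  zero g hg U t := by rw [hins 0 g hg U t, hins 0 g hg U 0]; rfl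
  succ k g hg U t i := by
    rw [hins (k + 1) g hg U t, hins (k + 1) g hg U 0, insOfChannel, insOfChannel, read_tableOf (hbdd k g hg t),
      read_tableOf (hbdd k g hg 0), channelTable, channelTable, constFam_zero, hT0 k g hg, Complex.ofReal_zero, sub_zero]

end InsOfChannel

/-! ## §3 The boundedness discharged on finite-per-scale carriers; the reading from the channel's binders -/

section Bounded

variable {T : ℕ → (ℕ → ℝ) → (Bg → C.Dom → ℝ) → ι → ℝ} {out : F.Idx → ι} {W : Set (ℕ → ℝ)} {Adm : Set (Bg → C.Dom → ℝ)}

/-- [folklore] The one-creation-step restriction of a constant family is the constant family of the restricted table. -/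
theorem restrictScale_constFam (j : ℕ) (t : C.Dom → ℝ) :
    restrictScale j (constFam (Bg := Bg) t) = constFam fun X => if C.scale X = j then t X else 0 := rfl

/-- [folklore] The scale-`j` majorant of a table over a finite scale catalogue: `N_j(t) := Σ_{X ∈ domAt j} |t X|·e^{κd(X)}` dominates every
scale-`j` entry in the form `|t X| ≤ e^{−κd(X)}·N_j(t)`. -/
theorem abs_le_exp_mul_majorant {κ : ℝ} (domAt : ℕ → Finset C.Dom) (hdom : ∀ X, X ∈ domAt (C.scale X)) (t : C.Dom → ℝ) {j : ℕ}
    {X : C.Dom} (hX : C.scale X = j) :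
    |t X| ≤ Real.exp (-(κ * C.d X)) * ∑ Y ∈ domAt j, |t Y| * Real.exp (κ * C.d Y) := by
  have hmem : X ∈ domAt j := hX ▸ hdom X
  have hle : |t X| * Real.exp (κ * C.d X) ≤ ∑ Y ∈ domAt j, |t Y| * Real.exp (κ * C.d Y) :=
    Finset.single_le_sum (f := fun Y => |t Y| * Real.exp (κ * C.d Y))
      (fun Y _ => mul_nonneg (abs_nonneg _) (Real.exp_pos _).le) hmem
  calc |t X| = Real.exp (-(κ * C.d X)) * (|t X| * Real.exp (κ * C.d X)) := by
        rw [mul_left_comm, Real.exp_neg, inv_mul_cancel₀ (Real.exp_pos _).ne', mul_one]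
    _ ≤ Real.exp (-(κ * C.d X)) * ∑ Y ∈ domAt j, |t Y| * Real.exp (κ * C.d Y) :=
        mul_le_mul_of_nonneg_left hle (Real.exp_pos _).le

/-- [folklore] **THE CHANNEL TABLES ARE HIST VECTORS ON FINITE-PER-SCALE CARRIERS**: `ChannelTablesBounded T out W` from a scale catalogue
`domAt` (`∀ X, X ∈ domAt (C.scale X)`), admissible constant families, the printed STEP-SUM structure `ChannelStepSum Adm T`, row NE9's size
binder `ChannelSizeAtStepNN Adm T κ wt τ` with `0 ≤ τ`, and the weight dictionary `wt k (out i) ≤ rH k·F.wt i` — the bound is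
`rH k·Σ_{j ≤ k} τ k j·N_j(t)`. -/
theorem channelTablesBounded_of_size {κ : ℝ} {wt : ℕ → ι → ℝ} {τ : ℕ → ℕ → ℝ} {rH : ℕ → ℝ} (domAt : ℕ → Finset C.Dom)
    (hdom : ∀ X, X ∈ domAt (C.scale X)) (hadm : ∀ t : C.Dom → ℝ, constFam (Bg := Bg) t ∈ Adm) (hsum : ChannelStepSum Adm T)
    (hsize : ChannelSizeAtStepNN Adm T κ wt τ) (hτ0 : ∀ k j, 0 ≤ τ k j) (hwt : ∀ k i, wt k (out i) ≤ rH k * F.wt i) :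
    ChannelTablesBounded T out W := by
  intro k g _ t
  set N : ℕ → ℝ := fun j => ∑ Y ∈ domAt j, |t Y| * Real.exp (κ * C.d Y) with hN
  have hN0 : ∀ j, 0 ≤ N j := fun j => Finset.sum_nonneg fun Y _ => mul_nonneg (abs_nonneg _) (Real.exp_pos _).le
  refine ⟨rH k * ∑ j ∈ range (k + 1), τ k j * N j, fun i => ?_⟩
  have hS0 : 0 ≤ ∑ j ∈ range (k + 1), τ k j * N j := Finset.sum_nonneg fun j _ => mul_nonneg (hτ0 k j) (hN0 j)
  -- each one-creation-step piece of the constant family obeys the size binder with the majorant `N j`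
  have hstep : ∀ j ∈ range (k + 1), |T k g (restrictScale j (constFam (Bg := Bg) t)) (out i)| ≤ wt k (out i) * (τ k j * N j) := by
    intro j hj
    rw [restrictScale_constFam]
    refine hsize k j (Nat.lt_succ_iff.1 (mem_range.1 hj)) g _ (hadm _) (fun U X hX => ?_) (N j) (hN0 j) (fun U X hX => ?_)
      (out i)
    · simp only [constFam_apply, if_neg hX]
    · simp only [constFam_apply, if_pos hX]
      exact abs_le_exp_mul_majorant domAt hdom t hX
  rw [channelTable, Complex.norm_real, Real.norm_eq_abs, hsum k g _ (hadm t) (out i)]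
  calc |∑ j ∈ range (k + 1), T k g (restrictScale j (constFam t)) (out i)|
      ≤ ∑ j ∈ range (k + 1), |T k g (restrictScale j (constFam t)) (out i)| := Finset.abs_sum_le_sum_abs _ _
    _ ≤ ∑ j ∈ range (k + 1), wt k (out i) * (τ k j * N j) := Finset.sum_le_sum hstep
    _ = wt k (out i) * ∑ j ∈ range (k + 1), τ k j * N j := by rw [Finset.mul_sum]
    _ ≤ rH k * F.wt i * ∑ j ∈ range (k + 1), τ k j * N j := mul_le_mul_of_nonneg_right (hwt k i) hS0
    _ = rH k * (∑ j ∈ range (k + 1), τ k j * N j) * F.wt i := by ring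

/-- [folklore] An additive channel kills the zero family (`0 ∈ Adm` as the constant family of the zero table). -/
theorem channel_zero_of_additive (hadd : ChannelAdditive Adm T) (hadm : ∀ t : C.Dom → ℝ, constFam (Bg := Bg) t ∈ Adm) (k : ℕ)
    (s : ℕ → ℝ) (y : ι) : T k s 0 y = 0 := by
  have h0 : (0 : Bg → C.Dom → ℝ) ∈ Adm := constFam_zero (C := C) (Bg := Bg) ▸ hadm 0
  have h := hadd k s 0 h0 0 h0 y
  rw [sub_self] at h
  linarith

variable {Op : Type*} [NormedAddCommGroup Op] [NormedSpace ℂ Op] {M : StepModel C Op (Hist F)}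

/-- [folklore] **THE READING BY CONSTRUCTION FROM THE CHANNEL'S BINDERS**: on finite-per-scale carriers, a step model whose run-A insertion
IS `insOfChannel T out` READS every ADDITIVE channel with the printed step-sum structure, row NE9's size binder (`0 ≤ τ`) and the weight
dictionary — `ReadsChannel M T out W` with NO reading hypothesis left. -/
theorem readsChannel_insOfChannel {κ : ℝ} {wt : ℕ → ι → ℝ} {τ : ℕ → ℕ → ℝ} {rH : ℕ → ℝ}
    (hins : ∀ k, ∀ g ∈ W, ∀ (U : C.BgB) (t : C.Dom → ℝ), M.insA g U k t = insOfChannel T out g k t)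
    (domAt : ℕ → Finset C.Dom) (hdom : ∀ X, X ∈ domAt (C.scale X)) (hadm : ∀ t : C.Dom → ℝ, constFam (Bg := Bg) t ∈ Adm)
    (hadd : ChannelAdditive Adm T) (hsum : ChannelStepSum Adm T) (hsize : ChannelSizeAtStepNN Adm T κ wt τ)
    (hτ0 : ∀ k j, 0 ≤ τ k j) (hwt : ∀ k i, wt k (out i) ≤ rH k * F.wt i) : ReadsChannel M T out W :=
  readsChannel_of_insA_eq hins (channelTablesBounded_of_size domAt hdom hadm hsum hsize hτ0 hwt)
    fun k g _ y => channel_zero_of_additive hadd hadm k g y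

end Bounded

/-! ## §4 Corollaries: NE9-P1's piece form and NE9-P2's evaluation channels are READ by construction -/

section Piece

variable {α β γ : Type} {P : PieceData C Bg ι α β γ} {out : F.Idx → ι} {W : Set (ℕ → ℝ)} {Op : Type*} [NormedAddCommGroup Op]
  [NormedSpace ℂ Op] {M : StepModel C Op (Hist F)}

/-- [folklore] **THE PIECE FORM IS READ BY CONSTRUCTION** on finite-per-scale carriers: for a step model with `insA = insOfChannel
(pieceChannel P) out`, `ReadsChannel M (pieceChannel P) out W` from the scale catalogue, `SrcScale`, the (1.24)×(1.25)-SHAPE `PieceBound`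
(row NE9's displayed binder), `LevelCounts` ((1.26)–(1.28)), `0 ≤ Kp`, `0 ≤ O1`, `1 < L` and the weight dictionary for `weightOf`
(`channelStepSum_piece` ∕ `channelAdditive_piece` on `univ`, `channelSizeAtStepNN_piece_printed` BY NAME).  With this, the END faces of
`InsertionChannelEnd` for the piece form FIRE on such models — the reading is no hypothesis. -/
theorem readsChannel_insOfPieceChannel {κ κ₁ d0 O1 L : ℝ} {Kp : ℕ → ι → ℝ} {rH : ℕ → ℝ}
    (hins : ∀ k, ∀ g ∈ W, ∀ (U : C.BgB) (t : C.Dom → ℝ), M.insA g U k t = insOfChannel (pieceChannel P) out g k t)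
    (domAt : ℕ → Finset C.Dom) (hdom : ∀ X, X ∈ domAt (C.scale X)) (hsrc : SrcScale P) (hL1 : 1 < L)
    (hPiece : PieceBound P κ κ₁ d0 Kp (ellPrinted L)) (hLev : LevelCounts P κ κ₁ O1 L (ellPrinted L)) (hKp : ∀ k y, 0 ≤ Kp k y)
    (hO1 : 0 ≤ O1) (hwt : ∀ k i, weightOf P κ₁ d0 O1 Kp k (out i) ≤ rH k * F.wt i) :
    ReadsChannel M (pieceChannel P) out W := by
  obtain ⟨hsize, hprof, hω, _⟩ := channelSizeAtStepNN_piece_printed hL1 hsrc hPiece hLev hKp hO1 (Set.univ : Set (Bg → C.Dom → ℝ))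
  have hτ0 : ∀ k j, 0 ≤ NE9Lemma1Counting.tauOf L (ellPrinted L) k j := fun k j =>
    mul_nonneg (by positivity) (NE9Lemma1Counting.ellPrinted_nonneg (by linarith) k j)
  exact readsChannel_insOfChannel hins domAt hdom (fun _ => Set.mem_univ _) (channelAdditive_piece P _) (channelStepSum_piece hsrc _)
    hsize hτ0 hwt

end Piece

section Eval

variable {Ω : Type*} [MeasurableSpace Ω] {F₀ : ℕ → (ℕ → ℝ) → ι → Finset C.Dom} {ν : ℕ → (ℕ → ℝ) → ι → C.Dom → Measure Ω}
  {w : ℕ → (ℕ → ℝ) → ι → C.Dom → Ω → ℝ} {bg : ℕ → (ℕ → ℝ) → ι → C.Dom → Ω → Bg} {out : F.Idx → ι} {W : Set (ℕ → ℝ)}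
  {Op : Type*} [NormedAddCommGroup Op] [NormedSpace ℂ Op] {M : StepModel C Op (Hist F)}

/-- [folklore] **EVALUATION CHANNELS ARE READ BY CONSTRUCTION** on finite-per-scale carriers: for a step model with `insA = insOfChannel
(evalChannel F₀ ν w bg) out`, `ReadsChannel` from the scale catalogue, integrable weights, source locality, THE KERNEL-MASS INEQUALITY with
`0 ≤ τ`, and the weight dictionary (`channelStepSum_eval` ∕ `channelAdditive_eval` ∕ `channelSizeAtStepNN_of_kernelMass` BY NAME). -/
theorem readsChannel_insOfEvalChannel {κ : ℝ} {wt : ℕ → ι → ℝ} {τ : ℕ → ℕ → ℝ} {rH : ℕ → ℝ}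
    (hins : ∀ k, ∀ g ∈ W, ∀ (U : C.BgB) (t : C.Dom → ℝ), M.insA g U k t = insOfChannel (evalChannel F₀ ν w bg) out g k t)
    (domAt : ℕ → Finset C.Dom) (hdom : ∀ X, X ∈ domAt (C.scale X))
    (hw : ∀ k s y, ∀ X ∈ F₀ k s y, Integrable (w k s y X) (ν k s y X)) (hF : ∀ k s y, ∀ X ∈ F₀ k s y, C.scale X ≤ k)
    (hmass : ∀ (k j : ℕ) (s : ℕ → ℝ) (y : ι),
      ∑ X ∈ (F₀ k s y).filter (fun X => C.scale X = j), Real.exp (-(κ * C.d X)) * ∫ ω', |w k s y X ω'| ∂(ν k s y X) ≤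
        wt k y * τ k j)
    (hτ0 : ∀ k j, 0 ≤ τ k j) (hwt : ∀ k i, wt k (out i) ≤ rH k * F.wt i) :
    ReadsChannel M (evalChannel F₀ ν w bg) out W :=
  readsChannel_insOfChannel hins domAt hdom (constFam_mem_evalAdm hw) channelAdditive_eval (channelStepSum_eval hF)
    (channelSizeAtStepNN_of_kernelMass hw hmass) hτ0 hwt

end Eval

/-! ## §5 On the carriers of record the scale catalogue is `B13Carriers.TwoRuns.domAt` -/

section Record

open Summit.QuantumFields.BalabanUV.T4Continuum.B13Carriers (TwoRuns)

variable {G : Type} [GaugeGroup G] (R : TwoRuns G)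

/-- [folklore] THE SCALE CATALOGUE OF THE CARRIERS OF RECORD: every domain of `B13Carriers.TwoRuns.carriers R` lies in the finite fibre
`R.domAt` of its creation step (`TwoRuns.mem_domAt`) — the finiteness hypothesis of §3 is MET on the record. -/
theorem scaleCatalogue_record (X : R.carriers.Dom) : X ∈ R.domAt (R.carriers.scale X) := (TwoRuns.mem_domAt R).2 rfl

variable {R} {F : HistFrame R.carriers} {T : ℕ → (ℕ → ℝ) → (Bg → R.carriers.Dom → ℝ) → ι → ℝ} {out : F.Idx → ι}
  {W : Set (ℕ → ℝ)} {Adm : Set (Bg → R.carriers.Dom → ℝ)} {Op : Type*} [NormedAddCommGroup Op] [NormedSpace ℂ Op]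
  {M : StepModel R.carriers Op (Hist F)}

/-- [folklore] **THE READING BY CONSTRUCTION ON THE CARRIERS OF RECORD**: for a step model on `B13Carriers.TwoRuns.carriers R` whose run-A
insertion IS `insOfChannel T out`, every ADDITIVE channel with the printed step-sum structure, row NE9's size binder (`0 ≤ τ`) and the
weight dictionary is READ (`ReadsChannel M T out W`) — no finiteness hypothesis left (`scaleCatalogue_record`). -/
theorem readsChannel_insOfChannel_record {κ : ℝ} {wt : ℕ → ι → ℝ} {τ : ℕ → ℕ → ℝ} {rH : ℕ → ℝ}
    (hins : ∀ k, ∀ g ∈ W, ∀ (U : R.carriers.BgB) (t : R.carriers.Dom → ℝ), M.insA g U k t = insOfChannel T out g k t)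
    (hadm : ∀ t : R.carriers.Dom → ℝ, constFam (Bg := Bg) t ∈ Adm) (hadd : ChannelAdditive Adm T) (hsum : ChannelStepSum Adm T)
    (hsize : ChannelSizeAtStepNN Adm T κ wt τ) (hτ0 : ∀ k j, 0 ≤ τ k j) (hwt : ∀ k i, wt k (out i) ≤ rH k * F.wt i) :
    ReadsChannel M T out W :=
  readsChannel_insOfChannel hins R.domAt (scaleCatalogue_record R) hadm hadd hsum hsize hτ0 hwt

end Record

end Summit.QuantumFields.BalabanUV.T4Continuum.InsertionChannelInstance

end
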